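import Summits.NavierStokesRegularity.NavierStokesRegularity.Theorems.OddMorawetzOddMorawetzLocalIdxCompleteSort
import HarnessLib

/-!
# Crux `OddMorawetzLocal` (stmt-NavierStokesRegularity-1376) — the monomial basis `idx k` is complete, duplicate-free and canonical

Stub `idx_complete` of the refutation of `OddMorawetzLocal` (line `registered`, lead c1).  The refutation represents
cubic isobaric jet densities by coefficient vectors on the monomial basis `idx k` of the computable jet algebra
(`OddMorawetzLocalJetAlgebra`); regrouping an arbitrary jet polynomial into basis coordinates needs that EVERY
canonical monomial of weight `k` (three variables, sorted by `sortVars`, sorted index lists of length `≤ 3`) is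
listed — part (a) — and identifying coefficients needs the list to be duplicate-free — part (b); part (c) records
that listed monomials are canonical of weight `k`.

Proof (Mathlib only, on top of the sorting lemmas of `…IdxCompleteSort`): membership in a shape block
`idxShape n₁ n₂ n₃` is `m = sortVars [v₁, v₂, v₃]` with `vᵢ ∈ varsOfOrder nᵢ` (elimination, all four cases), which
gives (c) and the shape invariant "orders of `m` `~ [n₁, n₂, n₃]`" separating distinct sorted shapes; within a block
the enumerated tuples are pairwise NOT permutations of each other (`pairsLE` / `triplesLE` list each multiset of a
duplicate-free list once, variables of different orders differ), and `sortVars l = sortVars l' → l ~ l'`, whence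
(b); for (a) the three variables of a canonical `m` are listed by increasing order (an insertion sort), the sorted
orders form a shape of `shapes k`, and `m = sortVars` of any listing of its variables by permutation invariance.
-/

noncomputable section

set_option linter.dupNamespace false

namespace Summit.NavierStokesRegularity.NavierStokesRegularity.Theorems.OddMorawetz

/-! ### Unordered pairs and triples of a list -/

/-- Membership in `pairsLE`. -/
theorem mem_pairsLE_iff {α : Type} {L : List α} {p : α × α} :
    p ∈ pairsLE L ↔ ∃ i j : Fin L.length, i ≤ j ∧ p = (L.get i, L.get j) := by
  simp only [pairsLE, List.mem_flatMap, List.mem_finRange, true_and, List.mem_ite_nil_right, List.mem_singleton]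

/-- Membership in `triplesLE`. -/
theorem mem_triplesLE_iff {α : Type} {L : List α} {t : α × α × α} :
    t ∈ triplesLE L ↔ ∃ i j m : Fin L.length, (i ≤ j ∧ j ≤ m) ∧ t = (L.get i, L.get j, L.get m) := by
  simp only [triplesLE, List.mem_flatMap, List.mem_finRange, true_and, List.mem_ite_nil_right,
    List.mem_singleton]

/-- The components of a listed pair are in the list. -/
theorem mem_of_mem_pairsLE {α : Type} {L : List α} {p : α × α} (h : p ∈ pairsLE L) : p.1 ∈ L ∧ p.2 ∈ L := by
  obtain ⟨i, j, -, rfl⟩ := mem_pairsLE_iff.1 h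
  exact ⟨List.get_mem _ _, List.get_mem _ _⟩

/-- The components of a listed triple are in the list. -/
theorem mem_of_mem_triplesLE {α : Type} {L : List α} {t : α × α × α} (h : t ∈ triplesLE L) :
    t.1 ∈ L ∧ t.2.1 ∈ L ∧ t.2.2 ∈ L := by
  obtain ⟨i, j, m, -, rfl⟩ := mem_triplesLE_iff.1 h
  exact ⟨List.get_mem _ _, List.get_mem _ _, List.get_mem _ _⟩

/-- `pairsLE` of a duplicate-free list is duplicate-free. -/
theorem nodup_pairsLE {α : Type} {L : List α} (hL : L.Nodup) : (pairsLE L).Nodup := by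
  have hinj := List.nodup_iff_injective_get.1 hL
  unfold pairsLE
  refine nodup_flatMap_of_key (List.nodup_finRange _) (fun i _ => ?_) Prod.fst L.get hinj (fun i _ p hp => ?_)
  · refine nodup_flatMap_of_key (List.nodup_finRange _) (fun j _ => by split <;> simp) Prod.snd L.get hinj
      (fun j _ p hp => ?_)
    simp only [List.mem_ite_nil_right, List.mem_singleton] at hp
    rw [hp.2]
  · simp only [List.mem_flatMap, List.mem_finRange, true_and, List.mem_ite_nil_right, List.mem_singleton] at hp
    obtain ⟨j, -, rfl⟩ := hp
    rfl

/-- `triplesLE` of a duplicate-free list is duplicate-free. -/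
theorem nodup_triplesLE {α : Type} {L : List α} (hL : L.Nodup) : (triplesLE L).Nodup := by
  have hinj := List.nodup_iff_injective_get.1 hL
  unfold triplesLE
  refine nodup_flatMap_of_key (List.nodup_finRange _) (fun i _ => ?_) Prod.fst L.get hinj (fun i _ t ht => ?_)
  · refine nodup_flatMap_of_key (List.nodup_finRange _) (fun j _ => ?_) (fun t => t.2.1) L.get hinj
      (fun j _ t ht => ?_)
    · refine nodup_flatMap_of_key (List.nodup_finRange _) (fun m _ => by split <;> simp) (fun t => t.2.2) L.get
        hinj (fun m _ t ht => ?_)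
      simp only [List.mem_ite_nil_right, List.mem_singleton] at ht
      rw [ht.2]
    · simp only [List.mem_flatMap, List.mem_finRange, true_and, List.mem_ite_nil_right, List.mem_singleton] at ht
      obtain ⟨m, -, rfl⟩ := ht
      rfl
  · simp only [List.mem_flatMap, List.mem_finRange, true_and, List.mem_ite_nil_right, List.mem_singleton] at ht
    obtain ⟨j, m, -, rfl⟩ := ht
    rfl

/-- Index lists with permutation-equivalent images in a duplicate-free list are permutation-equivalent. -/
theorem perm_of_map_get_perm {α : Type} {L : List α} (hL : L.Nodup) {is js : List (Fin L.length)}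
    (h : (is.map L.get).Perm (js.map L.get)) : is.Perm js := by
  classical
  have hinj := List.nodup_iff_injective_get.1 hL
  rw [List.perm_iff_count] at h ⊢
  intro i
  have hi := h (L.get i)
  rwa [List.count_map_of_injective _ _ hinj, List.count_map_of_injective _ _ hinj] at hi

/-- A listed pair is determined by its underlying multiset. -/
theorem pairsLE_eq_of_perm {α : Type} {L : List α} (hL : L.Nodup) {p q : α × α} (hp : p ∈ pairsLE L)
    (hq : q ∈ pairsLE L) (h : [p.1, p.2].Perm [q.1, q.2]) : p = q := by
  obtain ⟨i, j, hij, rfl⟩ := mem_pairsLE_iff.1 hp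
  obtain ⟨i', j', hij', rfl⟩ := mem_pairsLE_iff.1 hq
  have hperm : [i, j].Perm [i', j'] := perm_of_map_get_perm hL (by simpa using h)
  have heq : [i, j] = [i', j'] :=
    hperm.eq_of_pairwise (fun _ _ _ _ h₁ h₂ => le_antisymm h₁ h₂) (by simp [hij]) (by simp [hij'])
  simp only [List.cons.injEq, and_true] at heq
  rw [heq.1, heq.2]

/-- A listed triple is determined by its underlying multiset. -/
theorem triplesLE_eq_of_perm {α : Type} {L : List α} (hL : L.Nodup) {t t' : α × α × α} (ht : t ∈ triplesLE L)
    (ht' : t' ∈ triplesLE L) (h : [t.1, t.2.1, t.2.2].Perm [t'.1, t'.2.1, t'.2.2]) : t = t' := by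
  obtain ⟨i, j, m, ⟨hij, hjm⟩, rfl⟩ := mem_triplesLE_iff.1 ht
  obtain ⟨i', j', m', ⟨hij', hjm'⟩, rfl⟩ := mem_triplesLE_iff.1 ht'
  have hperm : [i, j, m].Perm [i', j', m'] := perm_of_map_get_perm hL (by simpa using h)
  have heq : [i, j, m] = [i', j', m'] :=
    hperm.eq_of_pairwise (fun _ _ _ _ h₁ h₂ => le_antisymm h₁ h₂) (by simp [hij, hjm, hij.trans hjm])
      (by simp [hij', hjm', hij'.trans hjm'])
  simp only [List.cons.injEq, and_true] at heq
  rw [heq.1, heq.2.1, heq.2.2]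

/-- Every unordered pair of entries is listed by `pairsLE` (in one of its two orders). -/
theorem exists_pairsLE_perm {α : Type} {L : List α} {x y : α} (hx : x ∈ L) (hy : y ∈ L) :
    ∃ p ∈ pairsLE L, [p.1, p.2].Perm [x, y] := by
  obtain ⟨i, rfl⟩ := List.get_of_mem hx
  obtain ⟨j, rfl⟩ := List.get_of_mem hy
  rcases le_total i j with h | h
  · exact ⟨(L.get i, L.get j), mem_pairsLE_iff.2 ⟨i, j, h, rfl⟩, List.Perm.refl _⟩
  · exact ⟨(L.get j, L.get i), mem_pairsLE_iff.2 ⟨j, i, h, rfl⟩, List.Perm.swap _ _ _⟩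

/-- Every unordered triple of entries is listed by `triplesLE` (in one of its orders). -/
theorem exists_triplesLE_perm {α : Type} {L : List α} {x y z : α} (hx : x ∈ L) (hy : y ∈ L) (hz : z ∈ L) :
    ∃ t ∈ triplesLE L, [t.1, t.2.1, t.2.2].Perm [x, y, z] := by
  obtain ⟨i, rfl⟩ := List.get_of_mem hx
  obtain ⟨j, rfl⟩ := List.get_of_mem hy
  obtain ⟨m, rfl⟩ := List.get_of_mem hz
  -- sort the three indices
  have hperm := List.perm_insertionSort (· ≤ ·) [i, j, m]
  have hsort : ([i, j, m].insertionSort (· ≤ ·)).Pairwise (· ≤ ·) := List.pairwise_insertionSort _ _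
  obtain ⟨a, b, c, habc⟩ := List.length_eq_three.1 (hperm.length_eq.trans rfl)
  rw [habc] at hperm hsort
  have hab : a ≤ b := List.rel_of_pairwise_cons hsort (by simp)
  have hbc : b ≤ c := List.rel_of_pairwise_cons (List.pairwise_cons.1 hsort).2 (by simp)
  exact ⟨(L.get a, L.get b, L.get c), mem_triplesLE_iff.2 ⟨a, b, c, ⟨hab, hbc⟩, rfl⟩,
    by simpa using hperm.map L.get⟩

/-! ### The shape blocks `idxShape n₁ n₂ n₃` -/

/-- Elimination: a monomial of the block `(n₁, n₂, n₃)` is `sortVars [v₁, v₂, v₃]` with `vᵢ ∈ varsOfOrder nᵢ`. -/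
theorem mem_idxShape {n₁ n₂ n₃ : ℕ} {m : List JVar} (h : m ∈ idxShape n₁ n₂ n₃) :
    ∃ v₁ ∈ varsOfOrder n₁, ∃ v₂ ∈ varsOfOrder n₂, ∃ v₃ ∈ varsOfOrder n₃, m = sortVars [v₁, v₂, v₃] := by
  unfold idxShape at h
  split_ifs at h with hA hB hC
  · obtain ⟨rfl, rfl⟩ := hA
    obtain ⟨t, ht, rfl⟩ := List.mem_map.1 h
    obtain ⟨h₁, h₂, h₃⟩ := mem_of_mem_triplesLE ht
    exact ⟨_, h₁, _, h₂, _, h₃, rfl⟩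
  · subst hB
    simp only [List.mem_flatMap, List.mem_map] at h
    obtain ⟨pr, hpr, v₃, hv₃, rfl⟩ := h
    obtain ⟨h₁, h₂⟩ := mem_of_mem_pairsLE hpr
    exact ⟨_, h₁, _, h₂, v₃, hv₃, rfl⟩
  · subst hC
    simp only [List.mem_flatMap, List.mem_map] at h
    obtain ⟨v₁, hv₁, pr, hpr, rfl⟩ := h
    obtain ⟨h₂, h₃⟩ := mem_of_mem_pairsLE hpr
    exact ⟨v₁, hv₁, _, h₂, _, h₃, rfl⟩
  · simp only [List.mem_flatMap, List.mem_map] at h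
    obtain ⟨v₁, hv₁, v₂, hv₂, v₃, hv₃, rfl⟩ := h
    exact ⟨v₁, hv₁, v₂, hv₂, v₃, hv₃, rfl⟩

/-- The shape invariant: the derivative orders of a monomial of the block `(n₁, n₂, n₃)` are `n₁, n₂, n₃` (as a
multiset). -/
theorem orders_perm_of_mem_idxShape {n₁ n₂ n₃ : ℕ} {m : List JVar} (h : m ∈ idxShape n₁ n₂ n₃) :
    (m.map fun v => v.2.length).Perm [n₁, n₂, n₃] := by
  obtain ⟨v₁, hv₁, v₂, hv₂, v₃, hv₃, rfl⟩ := mem_idxShape h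
  simpa [length_of_mem_varsOfOrder hv₁, length_of_mem_varsOfOrder hv₂, length_of_mem_varsOfOrder hv₃] using
    (perm_sortVars [v₁, v₂, v₃]).map fun v : JVar => v.2.length

/-- Introduction: `sortVars [v₁, v₂, v₃]` with `vᵢ ∈ varsOfOrder nᵢ` is in the block `(n₁, n₂, n₃)`. -/
theorem sortVars_mem_idxShape {n₁ n₂ n₃ : ℕ} {v₁ v₂ v₃ : JVar} (hv₁ : v₁ ∈ varsOfOrder n₁)
    (hv₂ : v₂ ∈ varsOfOrder n₂) (hv₃ : v₃ ∈ varsOfOrder n₃) : sortVars [v₁, v₂, v₃] ∈ idxShape n₁ n₂ n₃ := by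
  unfold idxShape
  split_ifs with hA hB hC
  · obtain ⟨rfl, rfl⟩ := hA
    obtain ⟨t, ht, hp⟩ := exists_triplesLE_perm hv₁ hv₂ hv₃
    exact List.mem_map.2 ⟨t, ht, sortVars_eq_of_perm hp⟩
  · subst hB
    obtain ⟨pr, hpr, hp⟩ := exists_pairsLE_perm hv₁ hv₂
    simp only [List.mem_flatMap, List.mem_map]
    exact ⟨pr, hpr, v₃, hv₃, sortVars_eq_of_perm (by simpa using hp.append_right [v₃])⟩
  · subst hC
    obtain ⟨pr, hpr, hp⟩ := exists_pairsLE_perm hv₂ hv₃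
    simp only [List.mem_flatMap, List.mem_map]
    exact ⟨v₁, hv₁, pr, hpr, sortVars_eq_of_perm (hp.cons v₁)⟩
  · simp only [List.mem_flatMap, List.mem_map]
    exact ⟨v₁, hv₁, v₂, hv₂, v₃, hv₃, rfl⟩

/-- A `flatMap` of `map`s over duplicate-free lists by a jointly injective function is duplicate-free. -/
theorem nodup_flatMap_map {α β γ : Type*} {l₁ : List α} {l₂ : List β} (h₁ : l₁.Nodup) (h₂ : l₂.Nodup)
    {f : α → β → γ} (hf : ∀ a ∈ l₁, ∀ b ∈ l₂, ∀ a' ∈ l₁, ∀ b' ∈ l₂, f a b = f a' b' → a = a' ∧ b = b') :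
    (l₁.flatMap fun a => l₂.map (f a)).Nodup :=
  List.nodup_flatMap.2
    ⟨fun a ha => h₂.map_on fun b hb b' hb' h => (hf a ha b hb a ha b' hb' h).2,
      h₁.pairwise_of_forall_ne fun a ha a' ha' hne c hc hc' => by
        obtain ⟨b, hb, rfl⟩ := List.mem_map.1 hc
        obtain ⟨b', hb', h⟩ := List.mem_map.1 hc'
        exact hne (hf a ha b hb a' ha' b' hb' h.symm).1⟩

/-- If `v ∈ l` by a permutation `[v, …] ~ l'`-style argument: a variable of order `n` occurring in a list of variables
of orders `≠ n` except at the head equals the head. -/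
theorem eq_head_of_mem_of_orders {n n₂ n₃ : ℕ} {v w₁ w₂ w₃ : JVar} (hv : v ∈ varsOfOrder n)
    (hw₂ : w₂ ∈ varsOfOrder n₂) (hw₃ : w₃ ∈ varsOfOrder n₃) (h₂ : n ≠ n₂) (h₃ : n ≠ n₃)
    (hmem : v ∈ [w₁, w₂, w₃]) : v = w₁ := by
  simp only [List.mem_cons, List.not_mem_nil, or_false] at hmem
  rcases hmem with h | h | h
  · exact h
  · exact absurd h (ne_of_mem_varsOfOrder hv hw₂ h₂)
  · exact absurd h (ne_of_mem_varsOfOrder hv hw₃ h₃)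

/-- The block of a sorted shape `n₁ ≤ n₂ ≤ n₃` is duplicate-free. -/
theorem nodup_idxShape {n₁ n₂ n₃ : ℕ} (h₁₂ : n₁ ≤ n₂) (h₂₃ : n₂ ≤ n₃) : (idxShape n₁ n₂ n₃).Nodup := by
  unfold idxShape
  split_ifs with hA hB hC
  · -- `n₁ = n₂ = n₃`: triples of one duplicate-free list
    obtain ⟨rfl, rfl⟩ := hA
    exact (nodup_triplesLE (nodup_varsOfOrder n₁)).map_on fun t ht t' ht' h =>
      triplesLE_eq_of_perm (nodup_varsOfOrder n₁) ht ht' (perm_of_sortVars_eq h)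
  · -- `n₁ = n₂ < n₃`
    subst hB
    have h₁₃ : n₃ ≠ n₁ := fun h => hA ⟨rfl, h.symm⟩
    refine nodup_flatMap_map (nodup_pairsLE (nodup_varsOfOrder n₁)) (nodup_varsOfOrder n₃)
      fun pr hpr v hv pr' hpr' v' hv' h => ?_
    have hp := perm_of_sortVars_eq h
    obtain ⟨hq₁, hq₂⟩ := mem_of_mem_pairsLE hpr'
    -- the order-`n₃` variable is determined
    have hmem : v ∈ [v', pr'.1, pr'.2] := by
      have : v ∈ [pr'.1, pr'.2, v'] := hp.subset (by simp)
      simp only [List.mem_cons, List.not_mem_nil, or_false] at this ⊢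
      tauto
    obtain rfl := eq_head_of_mem_of_orders hv hq₁ hq₂ h₁₃ h₁₃ hmem
    have hp2 : [pr.1, pr.2].Perm [pr'.1, pr'.2] := (List.perm_append_right_iff [v]).1 (by simpa using hp)
    exact ⟨pairsLE_eq_of_perm (nodup_varsOfOrder n₁) hpr hpr' hp2, rfl⟩
  · -- `n₁ < n₂ = n₃`
    subst hC
    refine nodup_flatMap_map (nodup_varsOfOrder n₁) (nodup_pairsLE (nodup_varsOfOrder n₂))
      fun v hv pr hpr v' hv' pr' hpr' h => ?_
    have hp := perm_of_sortVars_eq h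
    obtain ⟨hq₁, hq₂⟩ := mem_of_mem_pairsLE hpr'
    obtain rfl := eq_head_of_mem_of_orders hv hq₁ hq₂ hB hB (hp.subset (by simp))
    exact ⟨rfl, pairsLE_eq_of_perm (nodup_varsOfOrder n₂) hpr hpr' hp.cons_inv⟩
  · -- `n₁ < n₂ < n₃`: joint injectivity of `(v₁, v₂, v₃) ↦ sortVars [v₁, v₂, v₃]`
    have h₁₃ : n₁ ≠ n₃ := by omega
    have key : ∀ v₁ ∈ varsOfOrder n₁, ∀ v₂ ∈ varsOfOrder n₂, ∀ v₃ ∈ varsOfOrder n₃,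
        ∀ w₁ ∈ varsOfOrder n₁, ∀ w₂ ∈ varsOfOrder n₂, ∀ w₃ ∈ varsOfOrder n₃,
        sortVars [v₁, v₂, v₃] = sortVars [w₁, w₂, w₃] → v₁ = w₁ ∧ v₂ = w₂ ∧ v₃ = w₃ := by
      intro v₁ hv₁ v₂ hv₂ v₃ hv₃ w₁ hw₁ w₂ hw₂ w₃ hw₃ h
      have hp := perm_of_sortVars_eq h
      obtain rfl := eq_head_of_mem_of_orders hv₁ hw₂ hw₃ hB h₁₃ (hp.subset (by simp))
      have hp' := hp.cons_inv
      have e₂ : v₂ = w₂ := by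
        have hmem : v₂ ∈ [w₂, w₃] := hp'.subset (by simp)
        simp only [List.mem_cons, List.not_mem_nil, or_false] at hmem
        exact hmem.resolve_right (ne_of_mem_varsOfOrder hv₂ hw₃ hC)
      subst e₂
      exact ⟨rfl, rfl, List.singleton_perm_singleton.1 hp'.cons_inv⟩
    refine List.nodup_flatMap.2 ⟨fun v₁ hv₁ => ?_, ?_⟩
    · exact nodup_flatMap_map (nodup_varsOfOrder n₂) (nodup_varsOfOrder n₃)
        fun v₂ hv₂ v₃ hv₃ w₂ hw₂ w₃ hw₃ h => (key v₁ hv₁ v₂ hv₂ v₃ hv₃ v₁ hv₁ w₂ hw₂ w₃ hw₃ h).2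
    · refine (nodup_varsOfOrder n₁).pairwise_of_forall_ne fun v₁ hv₁ w₁ hw₁ hne m hm hm' => hne ?_
      simp only [List.mem_flatMap, List.mem_map] at hm hm'
      obtain ⟨v₂, hv₂, v₃, hv₃, rfl⟩ := hm
      obtain ⟨w₂, hw₂, w₃, hw₃, h⟩ := hm'
      exact (key v₁ hv₁ v₂ hv₂ v₃ hv₃ w₁ hw₁ w₂ hw₂ w₃ hw₃ h.symm).1

/-! ### The basis `idx k` -/

/-- Membership in `idx k`: membership in the block of a sorted shape of weight `k`. -/
theorem mem_idx_iff {k : ℕ} {m : List JVar} :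
    m ∈ idx k ↔ ∃ n₁ n₂ n₃, n₁ ≤ n₂ ∧ n₂ ≤ n₃ ∧ n₃ ≤ 3 ∧ n₁ + n₂ + n₃ = k ∧ m ∈ idxShape n₁ n₂ n₃ := by
  simp only [idx, List.mem_flatMap]
  constructor
  · rintro ⟨sh, hsh, hm⟩
    obtain ⟨n₁, n₂, n₃, h₁₂, h₂₃, h₃, hk, rfl⟩ := mem_shapes_iff.1 hsh
    exact ⟨n₁, n₂, n₃, h₁₂, h₂₃, h₃, hk, hm⟩
  · rintro ⟨n₁, n₂, n₃, h₁₂, h₂₃, h₃, hk, hm⟩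
    exact ⟨[n₁, n₂, n₃], mem_shapes_iff.2 ⟨n₁, n₂, n₃, h₁₂, h₂₃, h₃, hk, rfl⟩, hm⟩

/-- **Part (c).** Listed monomials are canonical: sorted, three variables with sorted index lists of length `≤ 3`,
weight `k`. -/
theorem canonical_of_mem_idx {k : ℕ} {m : List JVar} (hm : m ∈ idx k) :
    sortVars m = m ∧ m.length = 3 ∧ (∀ v ∈ m, sortIdx v.2 = v.2 ∧ v.2.length ≤ 3) ∧ monoWeight m = k := by
  obtain ⟨n₁, n₂, n₃, h₁₂, h₂₃, h₃, hk, hm⟩ := mem_idx_iff.1 hm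
  obtain ⟨v₁, hv₁, v₂, hv₂, v₃, hv₃, rfl⟩ := mem_idxShape hm
  obtain ⟨hl₁, hs₁⟩ := mem_varsOfOrder_iff.1 hv₁
  obtain ⟨hl₂, hs₂⟩ := mem_varsOfOrder_iff.1 hv₂
  obtain ⟨hl₃, hs₃⟩ := mem_varsOfOrder_iff.1 hv₃
  have hp := perm_sortVars [v₁, v₂, v₃]
  refine ⟨sortVars_sortVars _, by simp [hp.length_eq], fun v hv => ?_, ?_⟩
  · have hv' : v ∈ [v₁, v₂, v₃] := hp.subset hv
    simp only [List.mem_cons, List.not_mem_nil, or_false] at hv'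
    rcases hv' with rfl | rfl | rfl
    · exact ⟨hs₁, by omega⟩
    · exact ⟨hs₂, by omega⟩
    · exact ⟨hs₃, by omega⟩
  · unfold monoWeight
    rw [(hp.map _).sum_eq]
    simp only [List.map_cons, List.map_nil, List.sum_cons, List.sum_nil]
    omega

/-- **Part (a).** Every canonical monomial of weight `k` is listed in `idx k`. -/
theorem mem_idx_of_canonical {k : ℕ} {m : List JVar} (hsort : sortVars m = m) (hlen : m.length = 3)
    (hcan : ∀ v ∈ m, sortIdx v.2 = v.2 ∧ v.2.length ≤ 3) (hw : monoWeight m = k) : m ∈ idx k := by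
  -- list the three variables by increasing derivative order
  obtain ⟨s, hperm, hsorted⟩ :
      ∃ s : List JVar, s.Perm m ∧ s.Pairwise (fun v w : JVar => v.2.length ≤ w.2.length) := by
    haveI : Std.Total (fun v w : JVar => v.2.length ≤ w.2.length) := ⟨fun v w => le_total _ _⟩
    haveI : IsTrans JVar (fun v w : JVar => v.2.length ≤ w.2.length) := ⟨fun _ _ _ => le_trans⟩
    exact ⟨_, List.perm_insertionSort _ m, List.pairwise_insertionSort _ m⟩
  obtain ⟨w₁, w₂, w₃, rfl⟩ := List.length_eq_three.1 (hperm.length_eq.trans hlen)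
  have h₁₂ : w₁.2.length ≤ w₂.2.length := List.rel_of_pairwise_cons hsorted (by simp)
  have h₂₃ : w₂.2.length ≤ w₃.2.length := List.rel_of_pairwise_cons (List.pairwise_cons.1 hsorted).2 (by simp)
  obtain ⟨hs₁, -⟩ := hcan w₁ (hperm.subset (by simp))
  obtain ⟨hs₂, -⟩ := hcan w₂ (hperm.subset (by simp))
  obtain ⟨hs₃, hl₃⟩ := hcan w₃ (hperm.subset (by simp))
  have hk : w₁.2.length + w₂.2.length + w₃.2.length = k := by
    rw [← hw]
    unfold monoWeight
    rw [← (hperm.map _).sum_eq]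
    simp only [List.map_cons, List.map_nil, List.sum_cons, List.sum_nil]
    omega
  -- `m` is the sorting of any listing of its variables
  have hm : m = sortVars [w₁, w₂, w₃] := by rw [← hsort]; exact sortVars_eq_of_perm hperm.symm
  rw [hm]
  exact mem_idx_iff.2 ⟨_, _, _, h₁₂, h₂₃, hl₃, hk, sortVars_mem_idxShape (mem_varsOfOrder_iff.2 ⟨rfl, hs₁⟩)
    (mem_varsOfOrder_iff.2 ⟨rfl, hs₂⟩) (mem_varsOfOrder_iff.2 ⟨rfl, hs₃⟩)⟩

/-- **Part (b).** The basis `idx k` is duplicate-free. -/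
theorem nodup_idx (k : ℕ) : (idx k).Nodup := by
  unfold idx
  refine List.nodup_flatMap.2 ⟨fun sh hsh => ?_, ?_⟩
  · obtain ⟨n₁, n₂, n₃, h₁₂, h₂₃, -, -, rfl⟩ := mem_shapes_iff.1 hsh
    exact nodup_idxShape h₁₂ h₂₃
  · refine (nodup_shapes k).pairwise_of_forall_ne fun sh hsh sh' hsh' hne m hm hm' => hne ?_
    obtain ⟨n₁, n₂, n₃, h₁₂, h₂₃, -, -, rfl⟩ := mem_shapes_iff.1 hsh
    obtain ⟨n₁', n₂', n₃', h₁₂', h₂₃', -, -, rfl⟩ := mem_shapes_iff.1 hsh'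
    change m ∈ idxShape n₁ n₂ n₃ at hm
    change m ∈ idxShape n₁' n₂' n₃' at hm'
    have hp := (orders_perm_of_mem_idxShape hm).symm.trans (orders_perm_of_mem_idxShape hm')
    exact hp.eq_of_pairwise (fun _ _ _ _ h₁ h₂ => le_antisymm h₁ h₂) (by simp [h₁₂, h₂₃, h₁₂.trans h₂₃])
      (by simp [h₁₂', h₂₃', h₁₂'.trans h₂₃'])

/-- **Stub `idx_complete` (refutation of `OddMorawetzLocal`).** The monomial basis `idx k` lists every canonical
cubic monomial of weight `k` and jet orders `≤ 3` (a), exactly once (b), and lists nothing else (c). -/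
theorem idx_complete :
    (∀ (k : ℕ) (m : List JVar), sortVars m = m → m.length = 3 → (∀ v ∈ m, sortIdx v.2 = v.2 ∧ v.2.length ≤ 3) →
      monoWeight m = k → m ∈ idx k) ∧
    (∀ k : ℕ, (idx k).Nodup) ∧
    (∀ (k : ℕ) (m : List JVar), m ∈ idx k → sortVars m = m ∧ m.length = 3 ∧ (∀ v ∈ m, sortIdx v.2 = v.2 ∧ v.2.length ≤ 3) ∧
      monoWeight m = k) :=
  ⟨fun _ _ hsort hlen hcan hw => mem_idx_of_canonical hsort hlen hcan hw, nodup_idx,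
    fun _ _ hm => canonical_of_mem_idx hm⟩

end Summit.NavierStokesRegularity.NavierStokesRegularity.Theorems.OddMorawetz

end
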